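import Summits.RiemannHypothesis.RiemannHypothesis.Theorems.WeilTwoPrimeDeflM80XBase
import Literature.NumberTheory.LFunctions.WeilBlockRows
import Literature.NumberTheory.LFunctions.WeilBlockRowsPZ
import Summits.RiemannHypothesis.RiemannHypothesis.Theorems.WeilTwoPrimeDeflM80PDataDnE18
import HarnessLib

/-!
# Calibration certificate M80X: rows 30–35 of the even `D C = I` and rows 50–53 of the claim `D = Dn / Ls` for M80P's factored even inverse

`WeilCert.checkDCRow 0` (6 rows) and `WeilCert.checkDnRow` (4 rows, `weilCertDeflM80XDnE` / `weilCertDeflM80PLsE`) for certificate M80X, by `decide +kernel` (gen3 re-split: ≤ 6 DC rows per file for the gate's 600-s elaboration cap under the farm's load variance). Pure proof file.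
-/

set_option linter.dupNamespace false

noncomputable section

namespace Summit.RiemannHypothesis.RiemannHypothesis.Theorems.EvenWinsBeyondArch

open Literature.NumberTheory.LFunctions

set_option maxHeartbeats 0 in
/-- Kernel check of row 30 of the even `D C = I` (certificate M80X). [folklore] -/
theorem checkDCRow0_30_weilCertDeflM80X : weilCertDeflM80XBase.checkDCRow 0 30 = true := by
  decide +kernel

set_option maxHeartbeats 0 in
/-- Kernel check of row 31 of the even `D C = I` (certificate M80X). [folklore] -/
theorem checkDCRow0_31_weilCertDeflM80X : weilCertDeflM80XBase.checkDCRow 0 31 = true := by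
  decide +kernel

set_option maxHeartbeats 0 in
/-- Kernel check of row 32 of the even `D C = I` (certificate M80X). [folklore] -/
theorem checkDCRow0_32_weilCertDeflM80X : weilCertDeflM80XBase.checkDCRow 0 32 = true := by
  decide +kernel

set_option maxHeartbeats 0 in
/-- Kernel check of row 33 of the even `D C = I` (certificate M80X). [folklore] -/
theorem checkDCRow0_33_weilCertDeflM80X : weilCertDeflM80XBase.checkDCRow 0 33 = true := by
  decide +kernel

set_option maxHeartbeats 0 in
/-- Kernel check of row 34 of the even `D C = I` (certificate M80X). [folklore] -/
theorem checkDCRow0_34_weilCertDeflM80X : weilCertDeflM80XBase.checkDCRow 0 34 = true := by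
  decide +kernel

set_option maxHeartbeats 0 in
/-- Kernel check of row 35 of the even `D C = I` (certificate M80X). [folklore] -/
theorem checkDCRow0_35_weilCertDeflM80X : weilCertDeflM80XBase.checkDCRow 0 35 = true := by
  decide +kernel

-- ===== factored even inverse `D = Dn / Ls`: rows 50–53 =====
set_option maxHeartbeats 0 in
/-- Row 50 of `DnE/LsE` is row 50 of the even `D` (certificate M80X). [folklore] -/
theorem checkDnRow0_50_weilCertDeflM80X : weilCertDeflM80XBase.checkDnRow weilCertDeflM80XDnE weilCertDeflM80PLsE 0 50 = true := by
  decide +kernel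

set_option maxHeartbeats 0 in
/-- Row 51 of `DnE/LsE` is row 51 of the even `D` (certificate M80X). [folklore] -/
theorem checkDnRow0_51_weilCertDeflM80X : weilCertDeflM80XBase.checkDnRow weilCertDeflM80XDnE weilCertDeflM80PLsE 0 51 = true := by
  decide +kernel

set_option maxHeartbeats 0 in
/-- Row 52 of `DnE/LsE` is row 52 of the even `D` (certificate M80X). [folklore] -/
theorem checkDnRow0_52_weilCertDeflM80X : weilCertDeflM80XBase.checkDnRow weilCertDeflM80XDnE weilCertDeflM80PLsE 0 52 = true := by
  decide +kernel

set_option maxHeartbeats 0 in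
/-- Row 53 of `DnE/LsE` is row 53 of the even `D` (certificate M80X). [folklore] -/
theorem checkDnRow0_53_weilCertDeflM80X : weilCertDeflM80XBase.checkDnRow weilCertDeflM80XDnE weilCertDeflM80PLsE 0 53 = true := by
  decide +kernel

end Summit.RiemannHypothesis.RiemannHypothesis.Theorems.EvenWinsBeyondArch

end
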